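import Summits.Ventures.PercRepro.RankLevelSetColoopDeviceT22Nine
import Summits.Ventures.PercRepro.RankLevelSetLevelSixT22S1Cf10
import Summits.Ventures.PercRepro.RankLevelSetLevelSixT22S2Cf10
import Summits.Ventures.PercRepro.RankLevelSetLevelSixT22S3Cf10
import Summits.Ventures.PercRepro.RankLevelSetLevelSixT22S4Cf10
import Summits.Ventures.PercRepro.RankLevelSetLevelSixT22S5Cf10
import Summits.Ventures.PercRepro.RankLevelSetLevelSixT22S6Cf10

/-!
# PercRepro — THE CORE CELL `(22, 10)` MODULO ITS COLOOP-FREE CELL AND ITS `k = 7` ROW (p8 g13, S3)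

The coloop device on the cell `(22, 10)`: `k = #coloops ≥ 8` the trivial rows (`c025_core_six_twentytwo_ten_of_coloops`);
`1 ≤ k ≤ 6` the `k`-times scaled coloop-free cells at rank `22 − k` on the existing cell (`c025_core_six_t22_scaled{k}_cf10`,
ratios `0.925 / 0.884 / 0.831 / 0.803 / 0.828 / 0.938`); `k = 7` the device's inequality for the coloop-free part of rank `15`
(`h7`: it needs the coloop-free count at rank `15`, `0.528`); `k = 0` the coloop-free cell (`h0`, form (ii), `0.992`).
`c025_core_six_twentytwo_ten_of_free_seven` states the cell modulo `h0` and `h7`.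

Axioms: standard.
-/

open scoped Matroid

namespace PercRepro

namespace ThmN

open Matroid

variable {α : Type}

/-- **THE CORE CELL `(22, 10)` MODULO ITS COLOOP-FREE CELL (`h0`) AND ITS `k = 7` ROW (`h7`).** -/
theorem c025_core_six_twentytwo_ten_of_free_seven (M : Matroid α) [M.Finite]
    (hR : M.eRank = (22 : ℕ∞)) (hn : M.E.ncard = 22 + 10)
    (hfree : ∀ e ∈ M.E, ∃ A ⊆ M.E \ {e}, e ∉ M.closure A ∧ e ∉ M.closure ((M.E \ {e}) \ A))
    (h0 : ∀ N : Matroid α, ∀ [N.Finite], (∀ e ∈ N.E, ¬ N.IsColoop e) → N.eRank = (22 : ℕ∞) → N.E.ncard = 22 + 10 →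
      (∀ e ∈ N.E, ∃ A ⊆ N.E \ {e}, e ∉ N.closure A ∧ e ∉ N.closure ((N.E \ {e}) \ A)) → RLS N 22 6)
    (h7 : ∀ N : Matroid α, ∀ [N.Finite], (∀ e ∈ N.E, ¬ N.IsColoop e) → N.eRank = (15 : ℕ∞) → N.E.ncard = 15 + 10 →
      (∀ e ∈ N.E, ∃ A ⊆ N.E \ {e}, e ∉ N.closure A ∧ e ∉ N.closure ((N.E \ {e}) \ A)) →
      phiK 22 6 * (Matroid.topCount N 15 6 : ℚ) ≤
        ∑ i ∈ Finset.range (7 + 1), ((Nat.choose 7 i : ℕ) : ℚ) * (Matroid.midShift N i 22 6 : ℚ)) :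
    RLS M 22 6 := by
  classical
  have hfin : M.coloops.Finite := M.ground_finite.subset (Matroid.coloops_subset_ground M)
  by_cases h8 : 8 ≤ M.coloops.ncard
  · exact c025_core_six_twentytwo_ten_of_coloops M hR hn hfree h8
  by_cases h0' : M.coloops.ncard = 0
  · have hcf : ∀ e ∈ M.E, ¬ M.IsColoop e := by
      intro e _ he
      have : e ∈ M.coloops := he
      rw [(Set.ncard_eq_zero hfin).1 h0'] at this
      exact this
    exact h0 M hcf hR hn hfree
  set K : Finset α := hfin.toFinset with hKdef
  have hKset : (K : Set α) = M.coloops := by rw [hKdef, Set.Finite.coe_toFinset]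
  have hK : ∀ e ∈ K, M.IsColoop e := fun e he => by
    rw [hKdef, Set.Finite.mem_toFinset] at he
    exact he
  have hcard : K.card = M.coloops.ncard := by rw [hKdef, Set.ncard_eq_toFinset_card _ hfin]
  have hR' : M.eRank = ((22 : ℕ) : ℕ∞) := hR
  obtain ⟨hn0, hR0, hfree0, hk⟩ := delete_coloops_core_data M K hK hR' hn hfree
  have hcf0 : ∀ e ∈ (M ＼ (K : Set α)).E, ¬ (M ＼ (K : Set α)).IsColoop e := by
    intro e _
    rw [hKset]
    exact not_isColoop_delete_coloops M e
  by_cases h7' : K.card = 7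
  · -- the `k = 7` row
    have hR7 : (M ＼ (K : Set α)).eRank = (15 : ℕ∞) := by
      rw [hR0, h7']
      norm_num
    have hn7 : (M ＼ (K : Set α)).E.ncard = 15 + 10 := by
      rw [hn0, h7']
    have h := h7 (M ＼ (K : Set α)) hcf0 hR7 hn7 hfree0
    apply RLS_of_coloops_device M K hK (q := 5) (by norm_num) hR'
    rw [h7']
    simpa using h
  -- `1 ≤ k ≤ 6`: the scaled coloop-free cells
  have hk6 : K.card ≤ 6 := by omega
  have hk1 : 1 ≤ K.card := by omega
  have hs : phiK 22 6 / 2 ^ K.card * (Matroid.topCount (M ＼ (K : Set α)) (22 - K.card) 6 : ℚ) ≤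
      (Matroid.midCount (M ＼ (K : Set α)) (22 - K.card) 6 : ℚ) := by
    revert hn0 hR0
    generalize K.card = k at hk1 hk6 ⊢
    intro hn0 hR0
    interval_cases k
    · have h := c025_core_six_t22_scaled1_cf10 (M ＼ (K : Set α)) 21 le_rfl hcf0 (by simpa using hR0) (by simpa using hn0) hfree0
      norm_num at h ⊢
      exact h
    · have h := c025_core_six_t22_scaled2_cf10 (M ＼ (K : Set α)) 20 le_rfl hcf0 (by simpa using hR0) (by simpa using hn0) hfree0
      norm_num at h ⊢
      exact h
    · have h := c025_core_six_t22_scaled3_cf10 (M ＼ (K : Set α)) 19 le_rfl hcf0 (by simpa using hR0) (by simpa using hn0) hfree0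
      norm_num at h ⊢
      exact h
    · have h := c025_core_six_t22_scaled4_cf10 (M ＼ (K : Set α)) 18 le_rfl hcf0 (by simpa using hR0) (by simpa using hn0) hfree0
      norm_num at h ⊢
      exact h
    · have h := c025_core_six_t22_scaled5_cf10 (M ＼ (K : Set α)) 17 le_rfl hcf0 (by simpa using hR0) (by simpa using hn0) hfree0
      norm_num at h ⊢
      exact h
    · have h := c025_core_six_t22_scaled6_cf10 (M ＼ (K : Set α)) 16 le_rfl hcf0 (by simpa using hR0) (by simpa using hn0) hfree0
      norm_num at h ⊢
      exact h
  exact RLS_of_coloops_device_scaled M K hK (q := 5) (by norm_num) hR' hk hs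

end ThmN

end PercRepro
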